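import Mathlib

/-!
# T5HeisenbergCommutator — the Heisenberg unipotent radical of the Borel of the rank-one
unitary group U(ℍ ⊕ ⟨a⟩) lies in the commutator subgroup (cell pub-hodge-repro2, seat p3)

Companion of `T5UnipotentCommutator` (U(ℍ), 2 × 2) for the OTHER member of the dual pair of
T5-SUPPORT-p3 §14: the three-dimensional hermitian space `V_v = ℍ ⊕ ⟨a⟩` of Witt index one, with
Gram matrix `J_a = !![0, 0, 1; 0, a, 0; 1, 0, 0]` (`a = ā ≠ 0`). The Borel (stabiliser of the
isotropic line `e₁`) has unipotent radical the Heisenberg group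
`N = {n(y, z) = !![1, -a ȳ, z; 0, 1, y; 0, 0, 1] : z + z̄ + a ȳ y = 0}` and torus
`d(t) = diag(t, 1, t̄⁻¹)`.

* `unitaryJ a : Subgroup (GL (Fin 3) E)` — `{g | gᴴ J_a g = J_a}`.
* `heisUnit_mem_unitaryJ_iff`: `n(y, z) ∈ U(J_a) ↔ z + z̄ + a ȳ y = 0`; `diagUnit_mem_unitaryJ`.
* `commutator_diagUnit_heisUnit`: `⁅d(t), n(y, z)⁆ = n((t̄ - 1) y, (t t̄ - 1) z + a (t - 1) ȳ y)`.
* `heis_mem_commutator`: if some `t ≠ 0` has `t̄ ≠ 1` and `t t̄ ≠ 1`, every `n(y₀, z₀) ∈ N` is a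
  commutator `⁅d(t), n(y, z)⁆` with `n(y, z) ∈ N`, hence lies in `commutator (unitaryJ a)`.
* `character_heis_eq_one`: every character of `U(J_a)` is trivial on `N`.

With `T5SplittingTwist.coinvariantsKer_twist_of_le_commutator` this makes «cuspidality is
invariant under twisting by a character» kernel-checked for both members `U(W_v) ≅ U(ℍ)` and
`U(V_v) ≅ U(J_a)` of the pair, modulo the prose identification of MVW's parabolics (Q-7).
Honest scope: `3 × 3` matrices over an abstract star-field. Standard axioms.
-/

namespace Summit.Ventures.HodgeRepro2.T5HeisenbergCommutator

open Matrix
open scoped commutatorElement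

variable {E : Type*} [Field E] [StarRing E]

/-- The Gram matrix `J_a = !![0, 0, 1; 0, a, 0; 1, 0, 0]` of `ℍ ⊕ ⟨a⟩`. -/
def formJ (a : E) : Matrix (Fin 3) (Fin 3) E := !![0, 0, 1; 0, a, 0; 1, 0, 0]

/-- Conjugate transpose of an explicit `3 × 3` matrix. -/
theorem conjTranspose_fin_three (a b c d e f g h i : E) :
    (!![a, b, c; d, e, f; g, h, i])ᴴ =
      !![star a, star d, star g; star b, star e, star h; star c, star f, star i] := by
  ext i j
  fin_cases i <;> fin_cases j <;> rfl

/-- The underlying matrix of an element of `GL₃(E)`. -/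
abbrev mat (g : GL (Fin 3) E) : Matrix (Fin 3) (Fin 3) E := g

omit [StarRing E] in
/-- `mat (g * h) = mat g * mat h`. -/
theorem mat_mul (g h : GL (Fin 3) E) : mat (g * h) = mat g * mat h := rfl

omit [StarRing E] in
/-- `mat g * mat g⁻¹ = 1`. -/
theorem mat_mul_inv (g : GL (Fin 3) E) : mat g * mat g⁻¹ = 1 := by
  rw [← mat_mul, mul_inv_cancel]
  rfl

/-- The unitary group of `J_a`: `{g | gᴴ J_a g = J_a}` inside `GL₃(E)`. -/
def unitaryJ (a : E) : Subgroup (GL (Fin 3) E) where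
  carrier := {g | (mat g)ᴴ * formJ a * mat g = formJ a}
  one_mem' := by
    show (mat 1)ᴴ * formJ a * mat 1 = formJ a
    simp [mat]
  mul_mem' := by
    intro g h hg hh
    simp only [Set.mem_setOf_eq] at hg hh ⊢
    calc (mat (g * h))ᴴ * formJ a * mat (g * h)
        = (mat h)ᴴ * ((mat g)ᴴ * formJ a * mat g) * mat h := by
          rw [mat_mul, conjTranspose_mul]
          simp only [Matrix.mul_assoc]
      _ = formJ a := by rw [hg, hh]
  inv_mem' := by
    intro g hg
    simp only [Set.mem_setOf_eq] at hg ⊢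
    have h1 : (mat g⁻¹)ᴴ * (mat g)ᴴ = 1 := by
      rw [← conjTranspose_mul, mat_mul_inv, conjTranspose_one]
    calc (mat g⁻¹)ᴴ * formJ a * mat g⁻¹
        = (mat g⁻¹)ᴴ * ((mat g)ᴴ * formJ a * mat g) * mat g⁻¹ := by rw [hg]
      _ = ((mat g⁻¹)ᴴ * (mat g)ᴴ) * formJ a * (mat g * mat g⁻¹) := by
          simp only [Matrix.mul_assoc]
      _ = formJ a := by rw [h1, mat_mul_inv, Matrix.one_mul, Matrix.mul_one]

/-- Membership in `unitaryJ a`. -/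
theorem mem_unitaryJ_iff (a : E) (g : GL (Fin 3) E) :
    g ∈ unitaryJ a ↔ (mat g)ᴴ * formJ a * mat g = formJ a := Iff.rfl

/-! ## Heisenberg and diagonal elements -/

/-- The Heisenberg matrix `n(y, z) = !![1, -a ȳ, z; 0, 1, y; 0, 0, 1]`. -/
def heis (a y z : E) : Matrix (Fin 3) (Fin 3) E := !![1, -(a * star y), z; 0, 1, y; 0, 0, 1]

/-- The group law of the Heisenberg group: `n(y, z) n(y', z') = n(y + y', z + z' - a ȳ y')`. -/
theorem heis_mul (a y z y' z' : E) :
    heis a y z * heis a y' z' = heis a (y + y') (z + z' - a * star y * y') := by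
  simp only [heis, Matrix.mul_fin_three]
  congr 1
  funext i j
  fin_cases i <;> fin_cases j <;> simp [star_add] <;> ring

/-- `n(0, 0) = 1`. -/
theorem heis_zero (a : E) : heis a 0 0 = 1 := by
  simp [heis, Matrix.one_fin_three]

/-- `n(y, z)` as an element of `GL₃(E)`, with inverse `n(-y, -z - a ȳ y)`. -/
def heisUnit (a y z : E) : GL (Fin 3) E where
  val := heis a y z
  inv := heis a (-y) (-z - a * star y * y)
  val_inv := by
    rw [heis_mul]
    have h1 : y + -y = 0 := by ring
    have h2 : z + (-z - a * star y * y) - a * star y * -y = 0 := by ring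
    rw [h1, h2, heis_zero]
  inv_val := by
    rw [heis_mul]
    have h1 : -y + y = 0 := by ring
    have h2 : -z - a * star y * y + z - a * star (-y) * y = 0 := by
      rw [star_neg]; ring
    rw [h1, h2, heis_zero]

/-- The underlying matrix of `heisUnit a y z`. -/
@[simp]
theorem heisUnit_val (a y z : E) : mat (heisUnit a y z) = heis a y z := rfl

/-- The inverse of `heisUnit a y z`. -/
theorem heisUnit_inv (a y z : E) :
    (heisUnit a y z)⁻¹ = heisUnit a (-y) (-z - a * star y * y) := by
  ext : 1
  rfl

/-- `heisUnit` satisfies the Heisenberg group law. -/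
theorem heisUnit_mul (a y z y' z' : E) :
    heisUnit a y z * heisUnit a y' z' = heisUnit a (y + y') (z + z' - a * star y * y') := by
  ext : 1
  exact heis_mul a y z y' z'

/-- The Gram matrix of `J_a` in the basis moved by `n(y, z)`: only the `(3, 3)` entry changes. -/
theorem heis_gram (a : E) (ha : star a = a) (y z : E) :
    (heis a y z)ᴴ * formJ a * heis a y z = !![0, 0, 1; 0, a, 0; 1, 0, z + star z + a * star y * y] := by
  simp only [heis, formJ, conjTranspose_fin_three, Matrix.mul_fin_three]
  congr 1
  funext i j
  fin_cases i <;> fin_cases j <;> simp [star_mul, star_neg, star_star, ha] <;> ring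

/-- `n(y, z) ∈ U(J_a)` (with `ā = a`) if and only if `z + z̄ + a ȳ y = 0`. -/
theorem heisUnit_mem_unitaryJ_iff (a : E) (ha : star a = a) (y z : E) :
    heisUnit a y z ∈ unitaryJ a ↔ z + star z + a * star y * y = 0 := by
  rw [mem_unitaryJ_iff, heisUnit_val, heis_gram a ha y z, formJ]
  constructor
  · intro h
    have := congrFun (congrFun h 2) 2
    simpa using this
  · intro h
    rw [h]

/-- The diagonal matrix `d(t) = diag(t, 1, t̄⁻¹)`. -/
def diag (t : E) : Matrix (Fin 3) (Fin 3) E := !![t, 0, 0; 0, 1, 0; 0, 0, (star t)⁻¹]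

/-- `d(t)` as an element of `GL₃(E)` (`t ≠ 0`), with inverse `diag(t⁻¹, 1, t̄)`. -/
def diagUnit (t : E) (ht : t ≠ 0) : GL (Fin 3) E where
  val := diag t
  inv := !![t⁻¹, 0, 0; 0, 1, 0; 0, 0, star t]
  val_inv := by
    have hs : star t ≠ 0 := star_ne_zero.mpr ht
    simp [diag, Matrix.one_fin_three, mul_inv_cancel₀ ht, inv_mul_cancel₀ hs]
  inv_val := by
    have hs : star t ≠ 0 := star_ne_zero.mpr ht
    simp [diag, Matrix.one_fin_three, inv_mul_cancel₀ ht, mul_inv_cancel₀ hs]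

/-- The underlying matrix of `diagUnit t`. -/
@[simp]
theorem diagUnit_val (t : E) (ht : t ≠ 0) : mat (diagUnit t ht) = diag t := rfl

/-- The underlying matrix of `(diagUnit t)⁻¹`. -/
@[simp]
theorem diagUnit_inv_val (t : E) (ht : t ≠ 0) :
    mat (diagUnit t ht)⁻¹ = !![t⁻¹, 0, 0; 0, 1, 0; 0, 0, star t] := rfl

/-- `d(t) ∈ U(J_a)`. -/
theorem diagUnit_mem_unitaryJ (a t : E) (ht : t ≠ 0) : diagUnit t ht ∈ unitaryJ a := by
  have hs : star t ≠ 0 := star_ne_zero.mpr ht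
  rw [mem_unitaryJ_iff, diagUnit_val, diag, formJ, conjTranspose_fin_three, Matrix.mul_fin_three,
    Matrix.mul_fin_three]
  simp [star_star, star_inv₀, mul_inv_cancel₀ hs, inv_mul_cancel₀ ht]

/-! ## The commutator identity -/

/-- `d(t) n(y, z) d(t)⁻¹ = n(t̄ y, t t̄ z)`. -/
theorem diagUnit_mul_heisUnit_mul_inv (a t : E) (ht : t ≠ 0) (y z : E) :
    diagUnit t ht * heisUnit a y z * (diagUnit t ht)⁻¹ = heisUnit a (star t * y) (t * star t * z) := by
  have hs : star t ≠ 0 := star_ne_zero.mpr ht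
  ext : 1
  show mat (diagUnit t ht * heisUnit a y z * (diagUnit t ht)⁻¹) =
    mat (heisUnit a (star t * y) (t * star t * z))
  simp only [mat_mul, diagUnit_val, heisUnit_val, diagUnit_inv_val, diag, heis,
    Matrix.mul_fin_three]
  congr 1
  funext i j
  fin_cases i <;> fin_cases j <;>
    simp [star_mul, star_star, mul_inv_cancel₀ ht, inv_mul_cancel₀ hs] <;> ring

/-- The commutator `⁅d(t), n(y, z)⁆ = n((t̄ - 1) y, (t t̄ - 1) z + a (t - 1) ȳ y)`. -/
theorem commutator_diagUnit_heisUnit (a t : E) (ht : t ≠ 0) (y z : E) :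
    ⁅diagUnit t ht, heisUnit a y z⁆ =
      heisUnit a ((star t - 1) * y) ((t * star t - 1) * z + a * (t - 1) * star y * y) := by
  rw [commutatorElement_def, diagUnit_mul_heisUnit_mul_inv, heisUnit_inv, heisUnit_mul]
  congr 1
  · ring
  · rw [star_mul, star_star]
    ring

/-! ## The Heisenberg radical lies in the commutator subgroup -/

/-- `t t̄` and `t t̄ - 1` are fixed by the star. -/
theorem star_norm_sub_one (t : E) : star (t * star t - 1) = t * star t - 1 := by
  rw [star_sub, star_mul, star_star, star_one, mul_comm]

/-- Given `n(y₀, z₀) ∈ N` and `t` with `t̄ ≠ 1`, `t t̄ ≠ 1`, the pre-image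
`n(y, z) := n(y₀ / (t̄ - 1), (z₀ - a (t - 1) ȳ y) / (t t̄ - 1))` again lies in `N`. -/
theorem preimage_mem (a : E) (ha : star a = a) (t : E) (ht1 : star t ≠ 1) (ht2 : t * star t ≠ 1)
    (y₀ z₀ : E) (h0 : z₀ + star z₀ + a * star y₀ * y₀ = 0) :
    let y := y₀ / (star t - 1)
    let z := (z₀ - a * (t - 1) * star y * y) / (t * star t - 1)
    z + star z + a * star y * y = 0 := by
  intro y z
  have hu : star t - 1 ≠ 0 := sub_ne_zero.mpr ht1
  have hu' : t - 1 ≠ 0 := by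
    intro h
    apply ht1
    have : t = 1 := sub_eq_zero.mp h
    rw [this, star_one]
  have hc : t * star t - 1 ≠ 0 := sub_ne_zero.mpr ht2
  have hcs : star (t * star t - 1) = t * star t - 1 := star_norm_sub_one t
  have hy : star y = star y₀ / (t - 1) := by
    simp only [y, star_div₀, star_sub, star_star, star_one]
  have hy0 : y₀ = (star t - 1) * y := by
    simp only [y]
    field_simp
  have hys0 : star y₀ = (t - 1) * star y := by
    rw [hy]
    field_simp
  have hz : star z = (star z₀ - a * (star t - 1) * y * star y) / (t * star t - 1) := by
    simp only [z, star_div₀, star_sub, star_mul, star_star, star_one, ha, hcs]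
    ring
  rw [hz]
  simp only [z]
  rw [hys0, hy0] at h0
  field_simp
  linear_combination h0

/-- Every `n(y₀, z₀) ∈ N` is the commutator `⁅d(t), n(y, z)⁆` of the pre-image. -/
theorem heisUnit_eq_commutator (a : E) (t : E) (ht : t ≠ 0) (ht1 : star t ≠ 1)
    (ht2 : t * star t ≠ 1) (y₀ z₀ : E) :
    heisUnit a y₀ z₀ =
      ⁅diagUnit t ht, heisUnit a (y₀ / (star t - 1))
        ((z₀ - a * (t - 1) * star (y₀ / (star t - 1)) * (y₀ / (star t - 1))) /
          (t * star t - 1))⁆ := by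
  have hu : star t - 1 ≠ 0 := sub_ne_zero.mpr ht1
  have hc : t * star t - 1 ≠ 0 := sub_ne_zero.mpr ht2
  rw [commutator_diagUnit_heisUnit]
  have h1 : (star t - 1) * (y₀ / (star t - 1)) = y₀ := by field_simp
  have h2 : (t * star t - 1) *
      ((z₀ - a * (t - 1) * star (y₀ / (star t - 1)) * (y₀ / (star t - 1))) / (t * star t - 1)) +
      a * (t - 1) * star (y₀ / (star t - 1)) * (y₀ / (star t - 1)) = z₀ := by
    field_simp
    ring
  rw [h1, h2]

/-- The Heisenberg element `n(y₀, z₀) ∈ N`, viewed in `U(J_a)`, lies in the commutator subgroup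
of `U(J_a)` as soon as some `t ≠ 0` has `t̄ ≠ 1` and `t t̄ ≠ 1`. -/
theorem heis_mem_commutator (a : E) (ha : star a = a) (t : E) (ht : t ≠ 0) (ht1 : star t ≠ 1)
    (ht2 : t * star t ≠ 1) (y₀ z₀ : E) (h0 : z₀ + star z₀ + a * star y₀ * y₀ = 0) :
    (⟨heisUnit a y₀ z₀, (heisUnit_mem_unitaryJ_iff a ha y₀ z₀).mpr h0⟩ : unitaryJ a) ∈
      commutator (unitaryJ a) := by
  have hpre := preimage_mem a ha t ht1 ht2 y₀ z₀ h0
  simp only at hpre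
  have hd : diagUnit t ht ∈ unitaryJ a := diagUnit_mem_unitaryJ a t ht
  have hn : heisUnit a (y₀ / (star t - 1))
      ((z₀ - a * (t - 1) * star (y₀ / (star t - 1)) * (y₀ / (star t - 1))) / (t * star t - 1)) ∈
        unitaryJ a :=
    (heisUnit_mem_unitaryJ_iff a ha _ _).mpr hpre
  have heq : (⟨heisUnit a y₀ z₀, (heisUnit_mem_unitaryJ_iff a ha y₀ z₀).mpr h0⟩ : unitaryJ a) =
      ⁅(⟨diagUnit t ht, hd⟩ : unitaryJ a), ⟨_, hn⟩⁆ := by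
    apply Subtype.ext
    have h := heisUnit_eq_commutator a t ht ht1 ht2 y₀ z₀
    rw [commutatorElement_def] at h
    rw [commutatorElement_def, Subgroup.coe_mul, Subgroup.coe_mul, Subgroup.coe_mul,
      Subgroup.coe_inv, Subgroup.coe_inv]
    exact h
  rw [heq]
  exact Subgroup.commutator_mem_commutator (Subgroup.mem_top _) (Subgroup.mem_top _)

/-- Every character of `U(J_a)` with values in a commutative group is trivial on the Heisenberg
radical `N` (given some `t ≠ 0` with `t̄ ≠ 1` and `t t̄ ≠ 1`). -/
theorem character_heis_eq_one {A : Type*} [CommGroup A] (a : E) (ha : star a = a)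
    (χ : unitaryJ a →* A) (t : E) (ht : t ≠ 0) (ht1 : star t ≠ 1) (ht2 : t * star t ≠ 1)
    (y₀ z₀ : E) (h0 : z₀ + star z₀ + a * star y₀ * y₀ = 0) :
    χ ⟨heisUnit a y₀ z₀, (heisUnit_mem_unitaryJ_iff a ha y₀ z₀).mpr h0⟩ = 1 :=
  MonoidHom.mem_ker.mp
    (Abelianization.commutator_subset_ker χ
      (heis_mem_commutator a ha t ht ht1 ht2 y₀ z₀ h0))

/-- `t = 2` (star-fixed) has `t ≠ 0`, `t̄ = 2 ≠ 1` and `t t̄ = 4 ≠ 1` as soon as `2 ≠ 0` and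
`3 ≠ 0` in `E` (every field of characteristic `0`, e.g. a local field). -/
theorem two_works (h2 : (2 : E) ≠ 0) (h3 : (3 : E) ≠ 0) :
    (2 : E) ≠ 0 ∧ star (2 : E) ≠ 1 ∧ (2 : E) * star (2 : E) ≠ 1 := by
  rw [star_ofNat]
  refine ⟨h2, ?_, ?_⟩
  · intro h
    apply h3
    linear_combination 3 * h
  · intro h
    apply h3
    linear_combination h

end Summit.Ventures.HodgeRepro2.T5HeisenbergCommutator
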